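/-
Copyright (c) 2026 the pub-hodgecm-mathlib formalisation cell (harness21).  Prover seat hodgecm-mathlib-K2E3-p11 (g4),
Track B «K2-LIT» ∕ h413 (`stmt-HodgeConjecture-24833`), line `K2_E3_EllipticInputs`, unit U12 §L, kernel road «RICHARDSON» for (L-B_GL) at `N = 3`
(`sig_K2E3GLnNilpotentFourierRegularGeThree`), brick (R1a) «THE THREE NILPOTENT ORBITS OF 𝔤𝔩₃(F)».  2026-09-04.
-/
import Mathlib.LinearAlgebra.Matrix.Charpoly.Coeff
import Mathlib.LinearAlgebra.Matrix.NonsingularInverse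
import Mathlib.LinearAlgebra.Matrix.GeneralLinearGroup.Defs
import Mathlib.LinearAlgebra.Matrix.ToLin
import Mathlib.LinearAlgebra.FiniteDimensional.Lemmas
import Mathlib.GroupTheory.GroupAction.ConjAct
import HarnessLib

/-!
# K2_E3 road (h413), §L — kernel road «RICHARDSON» for (L-B_GL) at `N = 3`, brick (R1a): THE THREE NILPOTENT ORBITS OF `𝔤𝔩₃(F)`

Cell `pub/hodgecm-mathlib` (D-0151), Track B (21-frontier RULING «PUSH BOTH» 2026-09-03, director req624), seat K2E3-p11 (g4); dealer K2E3-plan (g3) «=»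
2026-09-04T04:11Z «(R1) stratification at N = 3 = p11».  `--supports stmt-HodgeConjecture-24833 --as helper`; THEOREMS ONLY (no definition ∕ instance ∕ notation ∕
named fact ∕ `sorry`); never imports `Cruxes/…/Lines`; Mathlib only.  COUNT-NEUTRAL: (L-B_GL) and its leaf (LBGL-ge3) stay OPEN; this is the orbit geometry
behind the stratification step (R1) «`J(𝒩)(𝔤𝔩₃) = ℂδ₀ ⊕ ℂμ_min ⊕ ℂμ_reg`» (HC Thm. 3.9 ∕ Cor. 3.10: `dim J(𝒩)` = number of nilpotent orbits), the `𝔤𝔩₃` twin of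
★ `K2E3GL2RegularNilpotentOrbitStructure.exists_units_conj_nilp_one_eq` ∕ ★ `K2E3GL2RegularNilpotentOrbitSpace.mem_orbit_nilpOne_iff`.

THE MATHEMATICS (Jordan normal form of a nilpotent `3 × 3` matrix over ANY field `F`, written basis-free).  Let `X ∈ 𝔤𝔩₃(F)` be nilpotent; then `X³ = 0`
(Cayley–Hamilton, §1).  Put `J = E₁₂ + E₂₃ = [[0,1,0],[0,0,1],[0,0,0]]` (regular) and `E = E₁₃ = [[0,0,1],[0,0,0],[0,0,0]]` (minimal = subregular for `𝔤𝔩₃`).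
* §2 **`X² ≠ 0` ⇒ `X = g J g⁻¹`** (`exists_units_conj_nilpReg_eq`): for `v` with `X²v ≠ 0` the columns `g = [X²v | Xv | v]` are independent (apply `X²`, then `X`)
  and `X g = g J`.
* §3 **`X² = 0`, `X ≠ 0` ⇒ `X = g E g⁻¹`** (`exists_units_conj_nilpMin_eq`): `im X ≤ ker X` forces `dim ker X = 2` (rank–nullity), so for `v` with `u = Xv ≠ 0` there is
  `w ∈ ker X ∖ Fu`, and `g = [u | w | v]` is invertible with `X g = g E`.
* §4 the ORBITS as sets: `Ad(GL₃)·J = {X | X³ = 0 ∧ X² ≠ 0}`, `Ad(GL₃)·E = {X | X² = 0 ∧ X ≠ 0}` (`mem_orbit_nilpReg_iff`, `mem_orbit_nilpMin_iff`, for the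
  `ConjAct (GL (Fin 3) F)`-action on `Matrix (Fin 3) (Fin 3) F`), the trichotomy `𝒩 = {0} ⊔ Ad·E ⊔ Ad·J` (`eq_zero_or_mem_orbit_of_isNilpotent`), and
  `IsNilpotent X ↔ X³ = 0`.
* the complement of the regular orbit in `𝒩` is the stratum `{X² = 0} = Ad·E ∪ {0}` (`setOf_pow_three_eq_zero_diff_orbit_nilpReg`) — the closure order
  `{0} < Ad·E < Ad·J`; the topology (local closedness, closures) follows in the stratification file from these set identities.
NOT here: the invariant measures on the two orbits (Richardson: ★ K1 Lie form + (R2)), the one-orbit uniqueness (★ S2c pattern), stabilisers.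

References: [HarishChandra1999AdmissibleDistributions] Harish-Chandra (DeBacker–Sally), *Admissible invariant distributions on reductive p-adic groups*, ULECT 16
(1999), §3 pp. 8–10, Thm. 3.9, Cor. 3.10 · [Howe1974] R. Howe, *The Fourier transform and germs of characters*, Math. Ann. 208 (1974), §2 (nilpotent orbits of
`GL_n` by partitions); the Jordan types `(3)`, `(2,1)`, `(1,1,1)` are folklore.
HONEST LABEL: HC_CM is proved only modulo the 7 printed citations (2 remaining named inputs: hLiu418 = stmt-HodgeConjecture-24832, h413 = stmt-HodgeConjecture-24833)
until rung 0 closes; count-neutral helper.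
-/

set_option autoImplicit false
set_option linter.dupNamespace false   -- `Summit.HodgeConjecture.HodgeConjecture.…` (D-0017 nested layout; lakefile exemption for Summits)

noncomputable section

open Matrix
open scoped MatrixGroups

namespace Summit.HodgeConjecture.HodgeConjecture.Cruxes.H413.K2E3GL3NilpotentOrbits

variable {F : Type*} [Field F]

/-! ## §1  Nilpotent `3 × 3` matrices: `X³ = 0`; the representatives `J = E₁₂ + E₂₃`, `E = E₁₃` -/

/-- A nilpotent `3 × 3` matrix over a field satisfies `X³ = 0` (Cayley–Hamilton: `charpoly X = t³`).
[cite: HarishChandra1999AdmissibleDistributions, §3 p. 8] -/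
theorem pow_three_eq_zero_of_isNilpotent {X : Matrix (Fin 3) (Fin 3) F} (hX : IsNilpotent X) : X ^ 3 = 0 := by
  have h1 : X.charpoly = Polynomial.X ^ 3 := by
    have h := (Matrix.isNilpotent_charpoly_sub_pow_of_isNilpotent hX).eq_zero
    rw [sub_eq_zero] at h
    simpa using h
  have h2 := Matrix.aeval_self_charpoly X
  rwa [h1, map_pow, Polynomial.aeval_X] at h2

/-- `IsNilpotent X ↔ X³ = 0` for `X ∈ 𝔤𝔩₃(F)`. [cite: HarishChandra1999AdmissibleDistributions, §3 p. 8] -/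
theorem isNilpotent_iff_pow_three_eq_zero (X : Matrix (Fin 3) (Fin 3) F) : IsNilpotent X ↔ X ^ 3 = 0 :=
  ⟨pow_three_eq_zero_of_isNilpotent, fun h => ⟨3, h⟩⟩

/-- `J² = E₁₃ ≠ 0`: the regular representative has non-zero square. [folklore] -/
theorem nilpReg_mul_nilpReg : (!![0, 1, 0; 0, 0, 1; 0, 0, 0] : Matrix (Fin 3) (Fin 3) F) * !![0, 1, 0; 0, 0, 1; 0, 0, 0] = !![0, 0, 1; 0, 0, 0; 0, 0, 0] := by
  ext i j; fin_cases i <;> fin_cases j <;> simp [Matrix.mul_apply, Fin.sum_univ_three]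

/-- `J³ = 0`. [folklore] -/
theorem nilpReg_pow_three : (!![0, 1, 0; 0, 0, 1; 0, 0, 0] : Matrix (Fin 3) (Fin 3) F) ^ 3 = 0 := by
  rw [pow_three, nilpReg_mul_nilpReg]
  ext i j; fin_cases i <;> fin_cases j <;> simp [Matrix.mul_apply, Fin.sum_univ_three]

/-- `E ≠ 0`. [folklore] -/
theorem nilpMin_ne_zero : (!![0, 0, 1; 0, 0, 0; 0, 0, 0] : Matrix (Fin 3) (Fin 3) F) ≠ 0 := by
  intro h
  have := congrFun (congrFun h 0) 2
  simp at this

/-- `E² = 0`. [folklore] -/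
theorem nilpMin_mul_nilpMin : (!![0, 0, 1; 0, 0, 0; 0, 0, 0] : Matrix (Fin 3) (Fin 3) F) * !![0, 0, 1; 0, 0, 0; 0, 0, 0] = 0 := by
  ext i j; fin_cases i <;> fin_cases j <;> simp [Matrix.mul_apply, Fin.sum_univ_three]

/-- `J² ≠ 0`. [folklore] -/
theorem nilpReg_mul_nilpReg_ne_zero : (!![0, 1, 0; 0, 0, 1; 0, 0, 0] : Matrix (Fin 3) (Fin 3) F) * !![0, 1, 0; 0, 0, 1; 0, 0, 0] ≠ 0 := by
  rw [nilpReg_mul_nilpReg]; exact nilpMin_ne_zero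

/-- `g Y g⁻¹ = 0 ↔ Y = 0`. [folklore] -/
theorem conj_eq_zero_iff (g : GL (Fin 3) F) (Y : Matrix (Fin 3) (Fin 3) F) :
    (g : Matrix (Fin 3) (Fin 3) F) * Y * ((g⁻¹ : GL (Fin 3) F) : Matrix (Fin 3) (Fin 3) F) = 0 ↔ Y = 0 := by
  rw [Units.mul_left_eq_zero, Units.mul_right_eq_zero]

/-- Conjugates of a matrix with square zero have square zero, and conversely: `(gXg⁻¹)² = gX²g⁻¹`. [folklore] -/
theorem conj_mul_conj_eq_zero_iff (g : GL (Fin 3) F) (X : Matrix (Fin 3) (Fin 3) F) :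
    (g : Matrix (Fin 3) (Fin 3) F) * X * ((g⁻¹ : GL (Fin 3) F) : Matrix (Fin 3) (Fin 3) F) *
        ((g : Matrix (Fin 3) (Fin 3) F) * X * ((g⁻¹ : GL (Fin 3) F) : Matrix (Fin 3) (Fin 3) F)) = 0 ↔ X * X = 0 := by
  rw [← pow_two, Units.conj_pow, conj_eq_zero_iff, pow_two]

/-- Conjugates of a non-zero matrix are non-zero. [folklore] -/
theorem conj_ne_zero (g : GL (Fin 3) F) {X : Matrix (Fin 3) (Fin 3) F} (hX : X ≠ 0) :
    (g : Matrix (Fin 3) (Fin 3) F) * X * ((g⁻¹ : GL (Fin 3) F) : Matrix (Fin 3) (Fin 3) F) ≠ 0 :=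
  fun h => hX ((conj_eq_zero_iff g X).1 h)

/-- Conjugation preserves nilpotency. [folklore] -/
theorem isNilpotent_conj (g : GL (Fin 3) F) {X : Matrix (Fin 3) (Fin 3) F} (hX : IsNilpotent X) :
    IsNilpotent ((g : Matrix (Fin 3) (Fin 3) F) * X * ((g⁻¹ : GL (Fin 3) F) : Matrix (Fin 3) (Fin 3) F)) := by
  obtain ⟨k, hk⟩ := hX
  refine ⟨k, ?_⟩
  rw [Units.conj_pow, hk, Matrix.mul_zero, Matrix.zero_mul]

/-! ## §2  Regular normal form: `X³ = 0`, `X² ≠ 0` ⇒ `X = g J g⁻¹` -/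

/-- **Regular nilpotent normal form in `𝔤𝔩₃(F)`** (any field): if `X³ = 0` and `X² ≠ 0` then `X = g J g⁻¹` with `J = E₁₂ + E₂₃`; `g = [X²v | Xv | v]` for any `v` with
`X²v ≠ 0`. [cite: HarishChandra1999AdmissibleDistributions, §3 p. 8] -/
theorem exists_units_conj_nilpReg_eq {X : Matrix (Fin 3) (Fin 3) F} (hX3 : X ^ 3 = 0) (hX2 : X * X ≠ 0) :
    ∃ g : GL (Fin 3) F, (g : Matrix (Fin 3) (Fin 3) F) * !![0, 1, 0; 0, 0, 1; 0, 0, 0] * ((g⁻¹ : GL (Fin 3) F) : Matrix (Fin 3) (Fin 3) F) = X := by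
  -- a vector `v` with `X²v ≠ 0`
  obtain ⟨i, j, hij⟩ : ∃ i j, (X * X) i j ≠ 0 := by
    by_contra h
    push Not at h
    exact hX2 (Matrix.ext fun i j => by rw [h i j]; rfl)
  set v : Fin 3 → F := Pi.single j 1 with hv_def
  set u₁ : Fin 3 → F := X.mulVec v with hu₁_def
  set u₂ : Fin 3 → F := X.mulVec u₁ with hu₂_def
  have hu₂v : u₂ = (X * X).mulVec v := by rw [hu₂_def, hu₁_def, Matrix.mulVec_mulVec]
  have hu₂ : u₂ ≠ 0 := by
    intro h
    have := congr_fun h i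
    rw [hu₂v, hv_def, Matrix.mulVec_single_one] at this
    exact hij this
  have hXu₂ : X.mulVec u₂ = 0 := by
    rw [hu₂v, Matrix.mulVec_mulVec, ← pow_two, ← pow_succ', hX3, Matrix.zero_mulVec]
  have hXXu₁ : (X * X).mulVec u₁ = 0 := by rw [← Matrix.mulVec_mulVec, ← hu₂_def, hXu₂]
  have hXXu₂ : (X * X).mulVec u₂ = 0 := by rw [← Matrix.mulVec_mulVec, hXu₂, Matrix.mulVec_zero]
  -- `g = [u₂ | u₁ | v]`
  set gM : Matrix (Fin 3) (Fin 3) F := Matrix.of fun r c => (![u₂, u₁, v] : Fin 3 → Fin 3 → F) c r with hgM_def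
  have hgM : ∀ d : Fin 3 → F, gM.mulVec d = d 0 • u₂ + d 1 • u₁ + d 2 • v := by
    intro d
    ext l
    simp [hgM_def, Matrix.mulVec, dotProduct, Fin.sum_univ_three]
    ring
  have hinj : Function.Injective gM.mulVec := by
    intro d d' hdd'
    have hd : gM.mulVec (d - d') = 0 := by rw [Matrix.mulVec_sub, hdd', sub_self]
    rw [hgM] at hd
    -- apply `X²`: only the `v`-coefficient survives
    have h2 : (d - d') 2 = 0 := by
      have := congr_arg (X * X).mulVec hd
      rw [Matrix.mulVec_add, Matrix.mulVec_add, Matrix.mulVec_smul, Matrix.mulVec_smul, Matrix.mulVec_smul, hXXu₂, hXXu₁, ← hu₂v,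
        smul_zero, smul_zero, zero_add, zero_add, Matrix.mulVec_zero] at this
      exact (smul_eq_zero.1 this).resolve_right hu₂
    -- apply `X`: only the `u₁`-coefficient survives
    have h1 : (d - d') 1 = 0 := by
      rw [h2, zero_smul, add_zero] at hd
      have := congr_arg X.mulVec hd
      rw [Matrix.mulVec_add, Matrix.mulVec_smul, Matrix.mulVec_smul, hXu₂, ← hu₂_def, smul_zero, zero_add, Matrix.mulVec_zero] at this
      exact (smul_eq_zero.1 this).resolve_right hu₂
    have h0 : (d - d') 0 = 0 := by
      rw [h2, h1, zero_smul, zero_smul, add_zero, add_zero] at hd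
      exact (smul_eq_zero.1 hd).resolve_right hu₂
    rw [← sub_eq_zero]
    ext l
    fin_cases l
    · exact h0
    · exact h1
    · exact h2
  obtain ⟨g, hg⟩ := Matrix.mulVec_injective_iff_isUnit.1 hinj
  refine ⟨g, ?_⟩
  -- `g J = X g`, column by column: `X u₂ = 0`, `X u₁ = u₂`, `X v = u₁`
  have hXu₂' : ∀ r, X r 0 * u₂ 0 + X r 1 * u₂ 1 + X r 2 * u₂ 2 = 0 := fun r => by
    have := congr_fun hXu₂ r
    simpa [Matrix.mulVec, dotProduct, Fin.sum_univ_three] using this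
  have hXu₁' : ∀ r, X r 0 * u₁ 0 + X r 1 * u₁ 1 + X r 2 * u₁ 2 = u₂ r := fun r => by
    have := congr_fun hu₂_def.symm r
    simpa [Matrix.mulVec, dotProduct, Fin.sum_univ_three] using this
  have hXv' : ∀ r, X r 0 * v 0 + X r 1 * v 1 + X r 2 * v 2 = u₁ r := fun r => by
    have := congr_fun hu₁_def.symm r
    simpa [Matrix.mulVec, dotProduct, Fin.sum_univ_three] using this
  have key : (g : Matrix (Fin 3) (Fin 3) F) * !![0, 1, 0; 0, 0, 1; 0, 0, 0] = X * (g : Matrix (Fin 3) (Fin 3) F) := by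
    rw [hg]
    ext r c
    fin_cases c <;> simp [hgM_def, Matrix.mul_apply, Fin.sum_univ_three, hXu₂', hXu₁', hXv']
  rw [key, Matrix.mul_assoc, Units.mul_inv, Matrix.mul_one]

/-! ## §3  Minimal normal form: `X² = 0`, `X ≠ 0` ⇒ `X = g E₁₃ g⁻¹` -/

/-- **Minimal (rank-one) nilpotent normal form in `𝔤𝔩₃(F)`** (any field): if `X² = 0` and `X ≠ 0` then `X = g E₁₃ g⁻¹`; `g = [Xv | w | v]` with `Xv ≠ 0` and
`w ∈ ker X ∖ F·Xv` (rank–nullity: `im X ≤ ker X` forces `dim ker X = 2`). [cite: HarishChandra1999AdmissibleDistributions, §3 p. 8] -/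
theorem exists_units_conj_nilpMin_eq {X : Matrix (Fin 3) (Fin 3) F} (hX2 : X * X = 0) (hX0 : X ≠ 0) :
    ∃ g : GL (Fin 3) F, (g : Matrix (Fin 3) (Fin 3) F) * !![0, 0, 1; 0, 0, 0; 0, 0, 0] * ((g⁻¹ : GL (Fin 3) F) : Matrix (Fin 3) (Fin 3) F) = X := by
  -- a vector `v` with `u = Xv ≠ 0`
  obtain ⟨i, j, hij⟩ : ∃ i j, X i j ≠ 0 := by
    by_contra h
    push Not at h
    exact hX0 (Matrix.ext fun i j => by rw [h i j]; rfl)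
  set v : Fin 3 → F := Pi.single j 1 with hv_def
  set u : Fin 3 → F := X.mulVec v with hu_def
  have hu : u ≠ 0 := by
    intro h
    have := congr_fun h i
    rw [hu_def, hv_def, Matrix.mulVec_single_one] at this
    exact hij this
  have hXu : X.mulVec u = 0 := by rw [hu_def, Matrix.mulVec_mulVec, hX2, Matrix.zero_mulVec]
  -- rank–nullity: `dim ker X ≥ 2`, so `ker X ⊋ F·u`
  have hle : LinearMap.range X.mulVecLin ≤ LinearMap.ker X.mulVecLin := by
    rintro _ ⟨w, rfl⟩
    rw [LinearMap.mem_ker, Matrix.mulVecLin_apply, Matrix.mulVecLin_apply, Matrix.mulVec_mulVec, hX2, Matrix.zero_mulVec]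
  have hsum := LinearMap.finrank_range_add_finrank_ker X.mulVecLin
  rw [Module.finrank_fin_fun] at hsum
  have hrange : 0 < Module.finrank F (LinearMap.range X.mulVecLin) := by
    refine Module.finrank_pos_iff_exists_ne_zero.2 ⟨⟨u, ⟨v, rfl⟩⟩, fun h => hu ?_⟩
    exact congrArg Subtype.val h
  have hmono := Submodule.finrank_mono hle
  have hspan : Module.finrank F (Submodule.span F ({u} : Set (Fin 3 → F))) = 1 := finrank_span_singleton hu
  have huker : u ∈ LinearMap.ker X.mulVecLin := by rw [LinearMap.mem_ker, Matrix.mulVecLin_apply, hXu]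
  have hlt : Submodule.span F ({u} : Set (Fin 3 → F)) < LinearMap.ker X.mulVecLin := by
    refine lt_of_le_of_ne ((Submodule.span_singleton_le_iff_mem _ _).2 huker) fun h => ?_
    have := congrArg (fun S : Submodule F (Fin 3 → F) => Module.finrank F S) h
    simp only [hspan] at this
    omega
  obtain ⟨w, hwker, hwnot⟩ := SetLike.exists_of_lt hlt
  have hXw : X.mulVec w = 0 := by rwa [LinearMap.mem_ker, Matrix.mulVecLin_apply] at hwker
  rw [Submodule.mem_span_singleton] at hwnot
  push Not at hwnot
  -- `g = [u | w | v]`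
  set gM : Matrix (Fin 3) (Fin 3) F := Matrix.of fun r c => (![u, w, v] : Fin 3 → Fin 3 → F) c r with hgM_def
  have hgM : ∀ d : Fin 3 → F, gM.mulVec d = d 0 • u + d 1 • w + d 2 • v := by
    intro d
    ext l
    simp [hgM_def, Matrix.mulVec, dotProduct, Fin.sum_univ_three]
    ring
  have hinj : Function.Injective gM.mulVec := by
    intro d d' hdd'
    have hd : gM.mulVec (d - d') = 0 := by rw [Matrix.mulVec_sub, hdd', sub_self]
    rw [hgM] at hd
    -- apply `X`: only the `v`-coefficient survives
    have h2 : (d - d') 2 = 0 := by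
      have := congr_arg X.mulVec hd
      rw [Matrix.mulVec_add, Matrix.mulVec_add, Matrix.mulVec_smul, Matrix.mulVec_smul, Matrix.mulVec_smul, hXu, hXw, ← hu_def,
        smul_zero, smul_zero, zero_add, zero_add, Matrix.mulVec_zero] at this
      exact (smul_eq_zero.1 this).resolve_right hu
    -- `w ∉ F·u`
    have h1 : (d - d') 1 = 0 := by
      rw [h2, zero_smul, add_zero] at hd
      by_contra h1
      refine hwnot (-((d - d') 1)⁻¹ * (d - d') 0) ?_
      have : (d - d') 1 • w = -((d - d') 0 • u) := eq_neg_of_add_eq_zero_right hd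
      calc (-((d - d') 1)⁻¹ * (d - d') 0) • u = -(((d - d') 1)⁻¹ • ((d - d') 0 • u)) := by rw [neg_mul, neg_smul, mul_smul]
        _ = ((d - d') 1)⁻¹ • ((d - d') 1 • w) := by rw [this, smul_neg]
        _ = w := by rw [smul_smul, inv_mul_cancel₀ h1, one_smul]
    have h0 : (d - d') 0 = 0 := by
      rw [h2, h1, zero_smul, zero_smul, add_zero, add_zero] at hd
      exact (smul_eq_zero.1 hd).resolve_right hu
    rw [← sub_eq_zero]
    ext l
    fin_cases l
    · exact h0
    · exact h1
    · exact h2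
  obtain ⟨g, hg⟩ := Matrix.mulVec_injective_iff_isUnit.1 hinj
  refine ⟨g, ?_⟩
  -- `g E₁₃ = X g`, column by column: `X u = 0`, `X w = 0`, `X v = u`
  have hXu' : ∀ r, X r 0 * u 0 + X r 1 * u 1 + X r 2 * u 2 = 0 := fun r => by
    have := congr_fun hXu r
    simpa [Matrix.mulVec, dotProduct, Fin.sum_univ_three] using this
  have hXw' : ∀ r, X r 0 * w 0 + X r 1 * w 1 + X r 2 * w 2 = 0 := fun r => by
    have := congr_fun hXw r
    simpa [Matrix.mulVec, dotProduct, Fin.sum_univ_three] using this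
  have hXv' : ∀ r, X r 0 * v 0 + X r 1 * v 1 + X r 2 * v 2 = u r := fun r => by
    have := congr_fun hu_def.symm r
    simpa [Matrix.mulVec, dotProduct, Fin.sum_univ_three] using this
  have key : (g : Matrix (Fin 3) (Fin 3) F) * !![0, 0, 1; 0, 0, 0; 0, 0, 0] = X * (g : Matrix (Fin 3) (Fin 3) F) := by
    rw [hg]
    ext r c
    fin_cases c <;> simp [hgM_def, Matrix.mul_apply, Fin.sum_univ_three, hXu', hXw', hXv']
  rw [key, Matrix.mul_assoc, Units.mul_inv, Matrix.mul_one]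

/-! ## §4  The orbits as sets: `Ad·J = {X³ = 0, X² ≠ 0}`, `Ad·E = {X² = 0, X ≠ 0}`, and the trichotomy of `𝒩` -/

/-- **The regular nilpotent orbit of `𝔤𝔩₃(F)`**: `Ad(GL₃(F))·J = {X | X³ = 0 ∧ X² ≠ 0}` (`ConjAct (GL (Fin 3) F)` acting on `𝔤𝔩₃(F)`).
[cite: HarishChandra1999AdmissibleDistributions, §3 pp. 8–10] -/
theorem mem_orbit_nilpReg_iff (X : Matrix (Fin 3) (Fin 3) F) :
    X ∈ MulAction.orbit (ConjAct (GL (Fin 3) F)) (!![0, 1, 0; 0, 0, 1; 0, 0, 0] : Matrix (Fin 3) (Fin 3) F) ↔ X ^ 3 = 0 ∧ X * X ≠ 0 := by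
  rw [MulAction.mem_orbit_iff]
  constructor
  · rintro ⟨g, rfl⟩
    rw [ConjAct.units_smul_def]
    refine ⟨?_, ?_⟩
    · rw [Units.conj_pow, nilpReg_pow_three, Matrix.mul_zero, Matrix.zero_mul]
    · rw [Ne, conj_mul_conj_eq_zero_iff]
      exact nilpReg_mul_nilpReg_ne_zero
  · rintro ⟨h3, h2⟩
    obtain ⟨g, hg⟩ := exists_units_conj_nilpReg_eq h3 h2
    exact ⟨ConjAct.toConjAct g, by rw [ConjAct.units_smul_def, ConjAct.ofConjAct_toConjAct, hg]⟩

/-- **The minimal nilpotent orbit of `𝔤𝔩₃(F)`**: `Ad(GL₃(F))·E₁₃ = {X | X² = 0 ∧ X ≠ 0}`. [cite: HarishChandra1999AdmissibleDistributions, §3 pp. 8–10] -/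
theorem mem_orbit_nilpMin_iff (X : Matrix (Fin 3) (Fin 3) F) :
    X ∈ MulAction.orbit (ConjAct (GL (Fin 3) F)) (!![0, 0, 1; 0, 0, 0; 0, 0, 0] : Matrix (Fin 3) (Fin 3) F) ↔ X * X = 0 ∧ X ≠ 0 := by
  rw [MulAction.mem_orbit_iff]
  constructor
  · rintro ⟨g, rfl⟩
    rw [ConjAct.units_smul_def]
    refine ⟨?_, conj_ne_zero _ nilpMin_ne_zero⟩
    rw [conj_mul_conj_eq_zero_iff]
    exact nilpMin_mul_nilpMin
  · rintro ⟨h2, h0⟩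
    obtain ⟨g, hg⟩ := exists_units_conj_nilpMin_eq h2 h0
    exact ⟨ConjAct.toConjAct g, by rw [ConjAct.units_smul_def, ConjAct.ofConjAct_toConjAct, hg]⟩

/-- Set form of the regular orbit: `Ad·J = {X | X³ = 0} ∩ {X | X² ≠ 0}`. [cite: HarishChandra1999AdmissibleDistributions, §3 p. 8] -/
theorem orbit_nilpReg_eq :
    (MulAction.orbit (ConjAct (GL (Fin 3) F)) (!![0, 1, 0; 0, 0, 1; 0, 0, 0] : Matrix (Fin 3) (Fin 3) F) : Set (Matrix (Fin 3) (Fin 3) F)) =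
      {X | X ^ 3 = 0} ∩ {X | X * X ≠ 0} := by
  ext X; exact mem_orbit_nilpReg_iff X

/-- Set form of the minimal orbit: `Ad·E₁₃ = {X | X² = 0} ∩ {0}ᶜ`. [cite: HarishChandra1999AdmissibleDistributions, §3 p. 8] -/
theorem orbit_nilpMin_eq :
    (MulAction.orbit (ConjAct (GL (Fin 3) F)) (!![0, 0, 1; 0, 0, 0; 0, 0, 0] : Matrix (Fin 3) (Fin 3) F) : Set (Matrix (Fin 3) (Fin 3) F)) =
      {X | X * X = 0} ∩ {0}ᶜ := by
  ext X; exact mem_orbit_nilpMin_iff X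

/-- `{X | X² = 0} = Ad·E₁₃ ∪ {0}` — the closure stratum of the minimal orbit. [cite: HarishChandra1999AdmissibleDistributions, §3 p. 8] -/
theorem setOf_mul_self_eq_zero_eq :
    {X : Matrix (Fin 3) (Fin 3) F | X * X = 0} =
      (MulAction.orbit (ConjAct (GL (Fin 3) F)) (!![0, 0, 1; 0, 0, 0; 0, 0, 0] : Matrix (Fin 3) (Fin 3) F) : Set (Matrix (Fin 3) (Fin 3) F)) ∪ {0} := by
  ext X
  simp only [Set.mem_setOf_eq, Set.mem_union, Set.mem_singleton_iff, mem_orbit_nilpMin_iff]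
  by_cases h : X = 0
  · simp [h]
  · simp [h]

/-- **Trichotomy of the nilpotent cone of `𝔤𝔩₃(F)`**: a nilpotent `X` is `0`, or in the minimal orbit `Ad·E₁₃`, or in the regular orbit `Ad·J`.
[cite: HarishChandra1999AdmissibleDistributions, Cor. 3.10 p. 10] -/
theorem eq_zero_or_mem_orbit_of_isNilpotent {X : Matrix (Fin 3) (Fin 3) F} (hX : IsNilpotent X) :
    X = 0 ∨ X ∈ MulAction.orbit (ConjAct (GL (Fin 3) F)) (!![0, 0, 1; 0, 0, 0; 0, 0, 0] : Matrix (Fin 3) (Fin 3) F) ∨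
      X ∈ MulAction.orbit (ConjAct (GL (Fin 3) F)) (!![0, 1, 0; 0, 0, 1; 0, 0, 0] : Matrix (Fin 3) (Fin 3) F) := by
  by_cases h0 : X = 0
  · exact Or.inl h0
  by_cases h2 : X * X = 0
  · exact Or.inr (Or.inl ((mem_orbit_nilpMin_iff X).2 ⟨h2, h0⟩))
  · exact Or.inr (Or.inr ((mem_orbit_nilpReg_iff X).2 ⟨pow_three_eq_zero_of_isNilpotent hX, h2⟩))

/-- Every element of either orbit is nilpotent. [cite: HarishChandra1999AdmissibleDistributions, §3 p. 8] -/
theorem isNilpotent_of_mem_orbit {X : Matrix (Fin 3) (Fin 3) F}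
    (h : X ∈ MulAction.orbit (ConjAct (GL (Fin 3) F)) (!![0, 0, 1; 0, 0, 0; 0, 0, 0] : Matrix (Fin 3) (Fin 3) F) ∨
      X ∈ MulAction.orbit (ConjAct (GL (Fin 3) F)) (!![0, 1, 0; 0, 0, 1; 0, 0, 0] : Matrix (Fin 3) (Fin 3) F)) : IsNilpotent X := by
  rcases h with h | h
  · exact ⟨2, by rw [pow_two]; exact ((mem_orbit_nilpMin_iff X).1 h).1⟩
  · exact ⟨3, ((mem_orbit_nilpReg_iff X).1 h).1⟩

/-- The two orbits are disjoint and miss `0`. [cite: HarishChandra1999AdmissibleDistributions, §3 p. 8] -/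
theorem orbit_nilpMin_disjoint_orbit_nilpReg :
    Disjoint (MulAction.orbit (ConjAct (GL (Fin 3) F)) (!![0, 0, 1; 0, 0, 0; 0, 0, 0] : Matrix (Fin 3) (Fin 3) F) : Set (Matrix (Fin 3) (Fin 3) F))
      (MulAction.orbit (ConjAct (GL (Fin 3) F)) (!![0, 1, 0; 0, 0, 1; 0, 0, 0] : Matrix (Fin 3) (Fin 3) F)) := by
  rw [Set.disjoint_left]
  intro X hmin hreg
  exact ((mem_orbit_nilpReg_iff X).1 hreg).2 ((mem_orbit_nilpMin_iff X).1 hmin).1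

/-- `0 ∉ Ad·E₁₃` and `0 ∉ Ad·J`. [folklore] -/
theorem zero_notMem_orbits :
    (0 : Matrix (Fin 3) (Fin 3) F) ∉ MulAction.orbit (ConjAct (GL (Fin 3) F)) (!![0, 0, 1; 0, 0, 0; 0, 0, 0] : Matrix (Fin 3) (Fin 3) F) ∧
    (0 : Matrix (Fin 3) (Fin 3) F) ∉ MulAction.orbit (ConjAct (GL (Fin 3) F)) (!![0, 1, 0; 0, 0, 1; 0, 0, 0] : Matrix (Fin 3) (Fin 3) F) :=
  ⟨fun h => ((mem_orbit_nilpMin_iff _).1 h).2 rfl, fun h => ((mem_orbit_nilpReg_iff _).1 h).2 (Matrix.mul_zero _)⟩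

/-- **The complement of the regular orbit in the nilpotent cone is the closed stratum `{X² = 0} = Ad·E₁₃ ∪ {0}`**: `𝒩 ∖ Ad·J = {X² = 0}`.
[cite: HarishChandra1999AdmissibleDistributions, Cor. 3.10 p. 10] -/
theorem setOf_pow_three_eq_zero_diff_orbit_nilpReg :
    {X : Matrix (Fin 3) (Fin 3) F | X ^ 3 = 0} \ (MulAction.orbit (ConjAct (GL (Fin 3) F)) (!![0, 1, 0; 0, 0, 1; 0, 0, 0] : Matrix (Fin 3) (Fin 3) F) : Set _) =
      {X | X * X = 0} := by
  ext X
  rw [Set.mem_sdiff, Set.mem_setOf_eq, Set.mem_setOf_eq, mem_orbit_nilpReg_iff]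
  constructor
  · rintro ⟨h3, h⟩
    by_contra h2
    exact h ⟨h3, h2⟩
  · intro h2
    refine ⟨by rw [pow_succ, pow_two, h2, Matrix.zero_mul], fun h => h.2 h2⟩

end Summit.HodgeConjecture.HodgeConjecture.Cruxes.H413.K2E3GL3NilpotentOrbits

end
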